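import Summits.MatrixMultiplication.MatrixMultiplication.Theorems.AbelianSTPPCensusFPQGenDefs
import Summits.MatrixMultiplication.MatrixMultiplication.Theorems.AbelianSTPPCensusFPQCore
import Summits.MatrixMultiplication.MatrixMultiplication.Theorems.AbelianSTPPCensusFP4Sound

/-!
# Rule FPq with an arbitrary label group `Λ` is SOUND: `H ⧸ P ≃+ Λ` and `IsSTPP` ⇒ `FPQ.AdmG Λ |H|`

Cell mm-stpp (rung F-M1), theory lane «past the walls» (seat mm-stpp-theory, gen 18).  The shape-level predicate `FPQ.AdmG Λ M`
(`AbelianSTPPCensusFPQGenDefs`) holds on the shape data of every STPP family with non-empty sets in a finite abelian group `H` that has a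
subgroup `P` of prime order with `H ⧸ P ≃+ Λ` (`FPQ.admG_of_isSTPP`, item format `FPQ.fpqGenSound`).  This is the non-cyclic companion of
`AbelianSTPPCensusFPQCycSound` (`Λ = ℤ/q`, `q` squarefree): at `q = 25` (`7675 = 25·307`) `Λ ∈ {ℤ/25, (ℤ/5)²}`, at `q = 64` (`832 = 64·13`) the
eleven abelian groups of order `64` — a kill at such an order is one certificate `¬ AdmG Λᵢ M a b c` per `Λᵢ` together with the classification
«every abelian `H` of order `M` has `H ⧸ P ≃+ Λᵢ` for some `i`» (not in this file).

PROOF.  A `GenLab` is an additive surjection `lab : H →+ Λ` with kernel `P`, `Nat.card P = p` (from `H ⧸ P ≃+ Λ`: `FPQ.nonempty_genLab`).  The class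
of label `l` of a finset is its part in the coset `base l + P` (`base` a section of `lab`), the `base l` are pairwise incongruent and complete, and
`base c − base g ≡ base (c − g)`; so `TargetOKG` at the true class counts is the representative-indexed core `AbelianSTPPCensusFPQCore` (p710111)
summed over `base(Λ)`; forms A and C are form B of the rotated families (`IsSTPP.rotate`, `FP4.diffUnion_swap_eq_image_neg`).
WHAT THIS IS NOT: no census number, no checker, no classification of the quotients, no `ω` statement — a necessary condition.
References: J. M. Pollard, J. London Math. Soc. (2) 8 (1974) 460–462 (tree `Literature.Combinatorics.Additive.pollard`); CKSU 2005 Def. 5.1.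
-/

set_option linter.dupNamespace false -- `MatrixMultiplication.MatrixMultiplication` (summit = problem, D-0017)
set_option autoImplicit false

namespace Summit.MatrixMultiplication.MatrixMultiplication.Theorems

open Finset

namespace FPQ

variable (Λ : Type) [AddCommGroup Λ] [Fintype Λ] [DecidableEq Λ]

/-- A `Λ`-LABELLING of a finite abelian group: a subgroup `P` with `p` elements and an additive surjection `lab : H → Λ` whose kernel is `P`
(the classes of `lab` are the cosets of `P`; `H ⧸ P ≃+ Λ`). [original] -/
structure GenLab (H : Type*) [AddCommGroup H] [Fintype H] (p : ℕ) where
  /-- the subgroup fibred over -/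
  P : AddSubgroup H
  /-- it has `p` elements -/
  card_P : Nat.card P = p
  /-- the labelling -/
  lab : H →+ Λ
  /-- every label occurs -/
  lab_surj : Function.Surjective lab
  /-- the kernel is `P` -/
  lab_eq_zero_iff : ∀ u, lab u = 0 ↔ u ∈ P

variable {Λ} {H : Type*} [AddCommGroup H] [Fintype H]

omit [Fintype Λ] [DecidableEq Λ] in
/-- **From a quotient isomorphism**: a subgroup `P` with `Nat.card P = p` and `H ⧸ P ≃+ Λ` give a `Λ`-labelling. [original] -/
theorem nonempty_genLab {p : ℕ} (P : AddSubgroup H) (hP : Nat.card P = p) (e : H ⧸ P ≃+ Λ) : Nonempty (GenLab Λ H p) := by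
  refine ⟨⟨P, hP, e.toAddMonoidHom.comp (QuotientAddGroup.mk' P), ?_, ?_⟩⟩
  · intro l
    obtain ⟨u, hu⟩ := QuotientAddGroup.mk'_surjective P (e.symm l)
    refine ⟨u, ?_⟩
    change e (QuotientAddGroup.mk' P u) = l
    rw [hu, AddEquiv.apply_symm_apply]
  · intro u
    change e (QuotientAddGroup.mk' P u) = 0 ↔ u ∈ P
    rw [AddEquiv.map_eq_zero_iff, QuotientAddGroup.mk'_apply, QuotientAddGroup.eq_zero_iff]

namespace GenLab

variable {p : ℕ} (L : GenLab Λ H p)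

/-- A section of the labelling. [bookkeeping] -/
noncomputable def base (l : Λ) : H := (L.lab_surj l).choose

omit [Fintype Λ] [DecidableEq Λ] in
/-- `lab (base l) = l`. [bookkeeping] -/
theorem lab_base (l : Λ) : L.lab (L.base l) = l := (L.lab_surj l).choose_spec

omit [Fintype Λ] [DecidableEq Λ] in
/-- Two elements have the same label iff they are congruent mod `P`. [bookkeeping] -/
theorem lab_eq_iff (u v : H) : L.lab u = L.lab v ↔ u - v ∈ L.P := by
  rw [← L.lab_eq_zero_iff, map_sub, sub_eq_zero]

/-- The class of label `l` of a finset. [bookkeeping] -/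
def cls (S : Finset H) (l : Λ) : Finset H := S.filter (fun u => L.lab u = l)

/-- The class counts of a finset, as a function on `Λ`. [bookkeeping] -/
def cnt (S : Finset H) : Λ → ℕ := fun l => (L.cls S l).card

omit [Fintype Λ] in
/-- The class of label `l` is the part in the coset of ANY element of label `l`. [bookkeeping] -/
theorem cls_eq_filter [DecidablePred (· ∈ L.P)] (S : Finset H) {l : Λ} {t : H} (ht : L.lab t = l) :
    L.cls S l = S.filter (fun u => u - t ∈ L.P) := by
  unfold cls
  refine filter_congr fun u _ => ?_
  rw [← L.lab_eq_iff, ht]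

omit [Fintype Λ] in
/-- In particular it is the part in the coset `base l + P`. [bookkeeping] -/
theorem cls_eq_part [DecidablePred (· ∈ L.P)] (S : Finset H) (l : Λ) :
    L.cls S l = S.filter (fun u => u - L.base l ∈ L.P) := L.cls_eq_filter S (L.lab_base l)

/-- The class counts sum to the size. [bookkeeping] -/
theorem sum_cnt (S : Finset H) : ∑ l, L.cnt S l = S.card := by
  unfold cnt cls
  rw [← card_eq_sum_card_fiberwise (f := L.lab) (t := univ) fun u _ => mem_univ _]

omit [Fintype Λ] in
/-- Each class count is `≤ p`. [bookkeeping] -/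
theorem cnt_le (S : Finset H) (l : Λ) : L.cnt S l ≤ p := by
  classical
  unfold cnt
  rw [L.cls_eq_part S l]
  have hPc : (univ.filter (· ∈ L.P)).card = p := by
    have h := L.card_P
    rw [Nat.card_eq_fintype_card, Fintype.card_subtype] at h
    exact h
  exact (card_part_le L.P S (L.base l)).trans (le_of_eq hPc)

variable [DecidableEq H]

omit [DecidableEq Λ] in
/-- The representatives `base(Λ)`: pairwise incongruent … [bookkeeping] -/
theorem base_transversal : ∀ g ∈ univ.image L.base, ∀ g' ∈ univ.image L.base, g - g' ∈ L.P → g = g' := by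
  intro g hg g' hg' hgg'
  obtain ⟨l, -, rfl⟩ := mem_image.mp hg
  obtain ⟨l', -, rfl⟩ := mem_image.mp hg'
  rw [← L.lab_eq_iff, L.lab_base, L.lab_base] at hgg'
  rw [hgg']

omit [DecidableEq Λ] in
/-- … and complete. [bookkeeping] -/
theorem base_complete : ∀ u : H, ∃ g ∈ univ.image L.base, u - g ∈ L.P :=
  fun u => ⟨L.base (L.lab u), mem_image_of_mem _ (mem_univ _), by rw [← L.lab_eq_iff, L.lab_base]⟩

omit [Fintype Λ] [DecidableEq Λ] [DecidableEq H] in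
/-- `base` is injective. [bookkeeping] -/
theorem base_injective : Function.Injective L.base := fun l l' h => by
  have := congrArg L.lab h
  rwa [L.lab_base, L.lab_base] at this

omit [DecidableEq Λ] in
/-- Re-indexing a sum over the representatives by the labels. [bookkeeping] -/
theorem sum_image_base {f : H → ℕ} : ∑ g ∈ univ.image L.base, f g = ∑ l, f (L.base l) := by
  rw [sum_image fun l _ l' _ h => L.base_injective h]

omit [Fintype Λ] [DecidableEq H] in
/-- The part of `S` in the coset `(base c − base g) + P` is the class of label `c − g`. [bookkeeping] -/
theorem filter_base_sub [DecidablePred (· ∈ L.P)] (S : Finset H) (c g : Λ) :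
    S.filter (fun u => u - (L.base c - L.base g) ∈ L.P) = L.cls S (c - g) :=
  (L.cls_eq_filter S (by rw [map_sub, L.lab_base, L.lab_base])).symm

omit [Fintype Λ] in
/-- The class counts of `−S` are those of `S` at the negated labels. [bookkeeping] -/
theorem cnt_image_neg (S : Finset H) (l : Λ) : L.cnt (S.image (fun u => -u)) l = L.cnt S (-l) := by
  unfold cnt cls
  refine card_bij' (fun x _ => -x) (fun x _ => -x) ?_ ?_ (fun x _ => neg_neg x) (fun x _ => neg_neg x)
  · intro x hx
    rw [mem_filter] at hx ⊢
    obtain ⟨y, hy, rfl⟩ := mem_image.mp hx.1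
    refine ⟨by simpa using hy, ?_⟩
    have h2 := hx.2
    rw [map_neg] at h2
    rw [neg_neg]
    exact neg_eq_iff_eq_neg.mp h2
  · intro x hx
    rw [mem_filter] at hx ⊢
    exact ⟨mem_image.mpr ⟨x, hx.1, rfl⟩, by rw [map_neg, hx.2, neg_neg]⟩

/-! ### Form B of an STPP family -/

open Literature.Computability.AlgebraicComplexity

variable {N : ℕ} {A B C : Fin N → Finset H}

/-- **One target class of form B for an STPP family** (non-empty sets): `TargetOKC` at the true class counts — the representative-indexed
inequalities of `AbelianSTPPCensusFPQCore` summed over `base(Λ)`. [original] -/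
theorem targetOKG_of_isSTPP (h : IsSTPP A B C) (hp : p.Prime) {vb : ℕ} (hvb : ∀ i, vb ≤ (B i).card) (c : Λ) :
    TargetOKG Λ p (univ.sup fun i => (B i).card) vb (L.cnt (diffUnion A B)) (L.cnt (diffUnion B C)) c (L.cnt (diffUnion A C) c) := by
  classical
  haveI : Fact p.Prime := ⟨hp⟩
  have hPc : (univ.filter (· ∈ L.P)).card = p := by
    have h := L.card_P
    rw [Nat.card_eq_fintype_card, Fintype.card_subtype] at h
    exact h
  -- the class counts as parts at the representatives
  have hx : ∀ g, ((diffUnion A B).filter (fun u => u - L.base g ∈ L.P)).card = L.cnt (diffUnion A B) g := fun g => by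
    unfold cnt; rw [L.cls_eq_part]
  have hy : ∀ g, ((diffUnion B C).filter (fun u => u - (L.base c - L.base g) ∈ L.P)).card = L.cnt (diffUnion B C) (c - g) :=
    fun g => by unfold cnt; rw [L.filter_base_sub]
  have hz : ((diffUnion A C).filter (fun u => u - L.base c ∈ L.P)).card = L.cnt (diffUnion A C) c := by
    unfold cnt; rw [L.cls_eq_part]
  refine ⟨L.cnt_le _ c, ?_, ?_, ?_, ?_⟩
  · -- (F1)
    intro τ hτ
    have key := classIneq_of_isSTPP h L.P hp hPc (univ.image L.base) L.base_transversal (L.base c) (fun u => τ (L.lab u))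
      (fun g hg => by
      obtain ⟨l, -, rfl⟩ := mem_image.mp hg
      rw [L.lab_base, hx, hy]
      exact hτ l)
    rw [L.sum_image_base, L.sum_image_base, hz] at key
    simp only [L.lab_base, hx, hy] at key
    exact key
  · -- (F2)
    have key := mass_of_isSTPP h L.P (univ.image L.base) L.base_complete (L.base c) hvb
    rw [L.sum_image_base, hz] at key
    simp only [hx, hy] at key
    exact key
  · -- (F3)
    intro hW
    have key := point_of_isSTPP h L.P (univ.image L.base) L.base_complete (L.base c) hvb (by rw [hz]; exact hW)
    rw [L.sum_image_base] at key
    simp only [hx, hy] at key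
    exact key
  · -- (PH)
    intro hW
    have key := excess_of_isSTPP h L.P hPc (univ.image L.base) L.base_transversal (L.base c) (by rw [hz]; exact hW)
    rw [L.sum_image_base] at key
    simp only [hx, hy] at key
    exact key

/-- **Form B of rule FPq (label group `Λ`) for an STPP family** (non-empty sets) carrying a `Λ`-labelling: the class counts of `X, Y, Z′` pass
`FormOKC`. [original] -/
theorem formOKG_of_isSTPP (h : IsSTPP A B C) (hA : ∀ i, (A i).Nonempty) (hB : ∀ i, (B i).Nonempty) (hC : ∀ i, (C i).Nonempty)
    (hp : p.Prime) {vb : ℕ} (hvb : ∀ i, vb ≤ (B i).card) :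
    FormOKG Λ p (univ.sup fun i => (B i).card) vb
      (pAB (fun i => (A i).card) (fun i => (B i).card) (fun i => (C i).card))
      (pBC (fun i => (A i).card) (fun i => (B i).card) (fun i => (C i).card))
      (pCA (fun i => (A i).card) (fun i => (B i).card) (fun i => (C i).card))
      (L.cnt (diffUnion A B)) (L.cnt (diffUnion B C)) (L.cnt (diffUnion A C)) := by
  refine ⟨?_, ?_, ?_, fun g => L.cnt_le _ g, fun g => L.cnt_le _ g, fun c => L.targetOKG_of_isSTPP h hp hvb c⟩
  · rw [L.sum_cnt]; exact STPPRepCount.card_diffUnion_AB h hC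
  · rw [L.sum_cnt]; exact STPPRepCount.card_diffUnion_BC h hA
  · rw [L.sum_cnt]; exact STPPRepCount.card_diffUnion_AC h hB

end GenLab

/-! ### Soundness -/

open Literature.Computability.AlgebraicComplexity

variable {N : ℕ}

/-- **Soundness of rule FPq with label group `Λ`**: an `IsSTPP` family with non-empty sets in a finite abelian `H` having a subgroup `P` of prime
order `p` with `H ⧸ P ≃+ Λ` satisfies `AdmG Λ |H|` at its shape list (form B is `GenLab.formOKG_of_isSTPP`, forms A and C are form B of the
rotated families `(C, A, B)`, `(B, C, A)`). [original] -/
theorem admG_of_isSTPP {p₀ : ℕ} (L : GenLab Λ H p₀) {A B C : Fin N → Finset H} (h : IsSTPP A B C)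
    (hne : ∀ i, (A i).Nonempty ∧ (B i).Nonempty ∧ (C i).Nonempty) :
    AdmG Λ (Fintype.card H) (fun i => (A i).card) (fun i => (B i).card) (fun i => (C i).card) := by
  intro p hM hp va vb vc hva hvb hvc
  classical
  have hA : ∀ i, (A i).Nonempty := fun i => (hne i).1
  have hB : ∀ i, (B i).Nonempty := fun i => (hne i).2.1
  have hC : ∀ i, (C i).Nonempty := fun i => (hne i).2.2
  -- the prime `p` of the rule is the `p₀` of the labelling: `|H| = |Λ|·p₀ = |Λ|·p`
  have hk : L.lab.ker = L.P := by
    ext u; rw [AddMonoidHom.mem_ker]; exact L.lab_eq_zero_iff u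
  have e : H ⧸ L.P ≃+ Λ :=
    (QuotientAddGroup.quotientAddEquivOfEq hk.symm).trans (QuotientAddGroup.quotientKerEquivOfSurjective L.lab L.lab_surj)
  have hcard : Fintype.card H = Fintype.card Λ * p₀ := by
    have h1 := AddSubgroup.card_eq_card_quotient_mul_card_addSubgroup L.P
    rw [Nat.card_eq_fintype_card, L.card_P, Nat.card_congr e.toEquiv, Nat.card_eq_fintype_card] at h1
    exact h1
  have hpp : p = p₀ := by
    have : Fintype.card Λ * p = Fintype.card Λ * p₀ := by rw [← hM, hcard]
    exact Nat.eq_of_mul_eq_mul_left Fintype.card_pos this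
  subst hpp
  refine ⟨L.cnt (diffUnion A B), L.cnt (diffUnion B C), L.cnt (diffUnion A C), L.formOKG_of_isSTPP h hA hB hC hp hvb, ?_, ?_⟩
  · have h' := L.formOKG_of_isSTPP h.rotate.rotate hC hA hB hp hva
    rw [FP4.diffUnion_swap_eq_image_neg A C, FP4.diffUnion_swap_eq_image_neg B C] at h'
    have e1 : L.cnt ((diffUnion A C).image (fun u => -u)) = fun g => L.cnt (diffUnion A C) (-g) := funext (L.cnt_image_neg _)
    have e2 : L.cnt ((diffUnion B C).image (fun u => -u)) = fun g => L.cnt (diffUnion B C) (-g) := funext (L.cnt_image_neg _)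
    rw [e1, e2] at h'
    exact h'
  · have h' := L.formOKG_of_isSTPP h.rotate hB hC hA hp hvc
    rw [FP4.diffUnion_swap_eq_image_neg A C, FP4.diffUnion_swap_eq_image_neg A B] at h'
    have e1 : L.cnt ((diffUnion A C).image (fun u => -u)) = fun g => L.cnt (diffUnion A C) (-g) := funext (L.cnt_image_neg _)
    have e2 : L.cnt ((diffUnion A B).image (fun u => -u)) = fun g => L.cnt (diffUnion A B) (-g) := funext (L.cnt_image_neg _)
    rw [e1, e2] at h'
    exact h'

/-- **`FPqGenSound`** — item format: every STPP family with non-empty sets in a finite abelian group `H` having a subgroup `P` of order `p` with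
`H ⧸ P ≃+ Λ` satisfies `AdmG Λ |H|` at its shape list (the rule itself only speaks when `|H| = |Λ|·p′` with `p′` prime, and then `p′ = p`). [original] -/
theorem fpqGenSound (Λ : Type) [AddCommGroup Λ] [Fintype Λ] [DecidableEq Λ] : ∀ (H : Type) [AddCommGroup H] [Fintype H] (p : ℕ) (P : AddSubgroup H), Nat.card P = p → Nonempty (H ⧸ P ≃+ Λ) →
    ∀ (N : ℕ) (A B C : Fin N → Finset H), IsSTPP A B C → (∀ i, (A i).Nonempty ∧ (B i).Nonempty ∧ (C i).Nonempty) →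
      AdmG Λ (Fintype.card H) (fun i => (A i).card) (fun i => (B i).card) (fun i => (C i).card) := by
  intro H _ _ p P hP he N A B C h hne
  classical
  obtain ⟨e⟩ := he
  obtain ⟨L⟩ := nonempty_genLab P hP e
  exact admG_of_isSTPP L h hne

/-- **Semantic bridge for certificates**: if `AdmG Λ M a b c` fails and all sizes are positive, no STPP family of shapes `(a, b, c)` lives in a finite
abelian group of order `M` that has a subgroup `P` with `H ⧸ P ≃+ Λ` (to conclude for ALL abelian groups of order `M`, combine the bridges of all
label groups `Λᵢ` of order `M / p` with the classification of the quotients). [original] -/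
theorem no_isSTPP_of_not_admG (Λ : Type) [AddCommGroup Λ] [Fintype Λ] [DecidableEq Λ] {M : ℕ} {a b c : Fin N → ℕ} (hk : ¬ AdmG Λ M a b c) (hpos : ∀ i, 0 < a i ∧ 0 < b i ∧ 0 < c i) :
    ∀ (H : Type) [AddCommGroup H] [Fintype H], Fintype.card H = M → ∀ (p : ℕ) (P : AddSubgroup H), Nat.card P = p → Nonempty (H ⧸ P ≃+ Λ) →
      ∀ (A B C : Fin N → Finset H), IsSTPP A B C →
        ¬ ((fun i => (A i).card) = a ∧ (fun i => (B i).card) = b ∧ (fun i => (C i).card) = c) := by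
  intro H _ _ hH p P hP he A B C h hs
  obtain ⟨ha, hb, hc⟩ := hs
  have hne : ∀ i, (A i).Nonempty ∧ (B i).Nonempty ∧ (C i).Nonempty := fun i =>
    ⟨card_pos.mp (by rw [show (A i).card = a i from congrFun ha i]; exact (hpos i).1),
     card_pos.mp (by rw [show (B i).card = b i from congrFun hb i]; exact (hpos i).2.1),
     card_pos.mp (by rw [show (C i).card = c i from congrFun hc i]; exact (hpos i).2.2)⟩
  have hU := fpqGenSound Λ H p P hP he N A B C h hne
  rw [hH, ha, hb, hc] at hU
  exact hk hU

end FPQ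

end Summit.MatrixMultiplication.MatrixMultiplication.Theorems
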